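import Literature.MathematicalPhysics.QuantumFieldTheory.BalabanImbrieJaffe1984to88.BIJ88ConvexWeights227
import Mathlib.Analysis.Calculus.MeanValue
import Mathlib.Analysis.SpecialFunctions.Trigonometric.Deriv

/-!
# `BalabanImbrieJaffe1984to88.BIJ88ConvexWeights227SecondDiff` — T. Bałaban, J. Imbrie, A. Jaffe, *Effective action and cluster properties of
the abelian Higgs model*, Commun. Math. Phys. **114** (1988) 257–315 [BalabanImbrieJaffe1988], Sect. 2 (2.27) p. 263 [PDF 7]:
*"The convex combination varies smoothly with (x₁ + x₂)/2"* — **THE SECOND DIFFERENCES OF p13's CONVEX WEIGHTS `λ_α` OF (2.27) ARE `O(s⁻²)`**: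
the weights `cwt s α x₁ x₂ = h_α((x₁+x₂)/2)²` of `BIJ88ConvexWeights227` ([6]'s partition function at the midpoint, squared; cube spacing `s`)
have lattice second differences in `x₁` bounded by `4π²/s²`, uniformly — the `C^{1,1}` half of *"varies smoothly"* (the Lipschitz half,
`O(s⁻¹)` first differences, is p13's `abs_cwt_sub_le`).

statement-level skeleton of published theorems with citation tags; proofs where landed; nothing here is a claim about the Yang–Mills mass gap

PDF held: `paper:balaban1988-cmp114-bij-abelian-higgs-effective-action` (journal page = PDF page + 256); p. 263 [PDF 7] re-read this session
(text layer).

CITATION HEADER (lean-in-tree rule).  Part of the lit-balaban TYPED SKELETON (HOME `run/shared/lean/pub/lit-balaban/`), PHASE-2 proof seat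
p29 gen 28 (unit `lit-balaban-p29-g28`; TAKING line HOME/STATUS.md 2026-08-22T22:01:27Z, file (2) of that line; free-target protocol
G.5-34(d)).  Row **C2.Eq2.27** (DEF; owner r18; the weights of record are p13's `BIJ88ConvexWeights227.cwt`, p246… — NOT modified here) and row
**C2.Claim@263** (*"Bounds analogous to (2.30), (2.31) hold for … Holder derivatives of G_{k,loc}(u) of order less than two"*): the order
`1 + θ` Hölder member of `G_{k,loc}` differentiates the row weights `x ↦ ζ″(x,y)λ_α(x,y)` TWICE in the output point, so it needs the second
differences of `λ_α` — supplied here — besides those of the cut-off (r18's product-form `BIJ88HkLocHolderTorus.zetaPi`).  Kind: theorems only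
(no definition, no `Prop`-valued fact; p13's/[6]'s declarations `clamp01`, `prof`, `hfun`, `cwt` used BY NAME).

THE PRINTED TEXT (verbatim, p. 263).  *"Define G̃_k(u; x₁, x₂) = Σ_α λ_αG_k(□_α, u; x₁, x₂) (2.27) as a convex combination of Neumann
propagators. The convex combination varies smoothly with (x₁ + x₂)/2; it involves at most 2^d terms and is concentrated on □_α when
(x₁ + x₂)/2 is near the center of □_α."*  [6] = [Balaban1983RegularityDecay] p. 575: *"h ∈ C₀^∞(]−2/3, 2/3[), h(x) = 1 for x ∈ [−1/3, 1/3],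
and it is chosen in such a way that Σ_{j∈Z} h_j² = 1"*.

THE MECHANISM (ours, declared).  The tree's profile is `prof t = cos((π/2)·clamp₀₁(3|t| − 1))` (`B4Sect5CubeBounds`, Lipschitz instead of
`C^∞`: its first derivative JUMPS at `|t| = 2/3`), and the weight is its SQUARE: `prof(t)² = (1 + cos(π·clamp₀₁(3|t| − 1)))/2 = ψ(3t − 1)·ψ(−3t − 1)`
with `ψ(u) = (1 + Ψ(u))/2`, `Ψ(u) = cos(π·clamp₀₁ u)` — and `Ψ` IS `C¹` on all of `ℝ` with `Ψ′(u) = −π sin(π·clamp₀₁ u)` (the one-sided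
derivatives `−π sin 0 = 0 = −π sin π` vanish at both clamping points, §2), `|Ψ′| ≤ π`, `Ψ′` `π²`-Lipschitz; hence (mean value theorem twice,
r18's `abs_secondDiff_cutoffProfile_le` pattern) `|Ψ(t+2h) − 2Ψ(t+h) + Ψ(t)| ≤ π²h²` (§3).  The discrete product rule
`Δ²(fg) = (Δ²f)·g₂ + f₀·(Δ²g) + 2(Δf)(Δg)` for factors with values in `[0,1]` (§4) gives `|Δ²_h prof²| ≤ (27π²/2)h²` along any arithmetic
progression of step `h` (§5), and the product structure `cwt s α x₁ x₂ = Π_μ prof(((x₁+x₂)_μ)/(2s) − α_μ)²` (one lattice step of `x₁` moves ONE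
factor's argument by `h = 1/(2s)`) gives the lattice second differences: one direction twice — a second difference of one factor; two
directions — a product of two first differences (each `≤ 3πh`), the remaining factors in `[0,1]` (§6).

WHAT IS PROVED (theorems only; 0 `sorry`; standard axioms).
* §1 clamp bookkeeping (private).  §2 **`hasDerivAt_cos_pi_clamp01`** (`Ψ′(u) = −π sin(π clamp₀₁ u)` at EVERY `u`), `abs_dcos_pi_clamp01_le`
  (`|Ψ′| ≤ π`), `abs_dcos_pi_clamp01_sub_le` (`Ψ′` is `π²`-Lipschitz), `abs_cos_pi_clamp01_sub_le` (`Ψ` is `π`-Lipschitz).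
* §3 **`abs_secondDiff_cos_pi_clamp01_le`**: `|Ψ(t + 2h) − 2Ψ(t + h) + Ψ(t)| ≤ π²h²`.
* §4 `secondDiff_mul` (the discrete product rule), `abs_secondDiff_mul_le`.
* §5 `prof_sq_eq` (`prof(t)² = ψ(3t−1)ψ(−3t−1)`), `abs_prof_sq_sub_le` (`|prof(a)² − prof(b)²| ≤ 3π|a − b|`), **`abs_secondDiff_prof_sq_le`**:
  `|prof(t+2h)² − 2prof(t+h)² + prof(t)²| ≤ (27π²/2)h²`.
* §6 `cwt_eq_prod_sq`, `abs_cwt_add_single_sub_le` (`|λ_α(x₁ + e_κ, x₂) − λ_α(x₁, x₂)| ≤ 3π/(2s)`), **`abs_cwt_secondDiff_le`**: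
  `|λ_α(x₁ + e_κ + e_λ, x₂) − λ_α(x₁ + e_κ, x₂) − λ_α(x₁ + e_λ, x₂) + λ_α(x₁, x₂)| ≤ 4π²/s²` for ALL directions `κ, λ` and all `s ≥ 1` — the
  printed *"varies smoothly"* at second order for the weights of record, modulus `O(s⁻²) = O((L/r(e_{k−1}))²)`.
HONEST SCOPE.  The weights only (as p13's file); constants `3π/(2s)` and `4π²/s²` explicit, not optimized; second differences in the first
argument (by the symmetry `cwt_comm` the same holds in the second); higher differences are NOT bounded (the profile squared is `C^{1,1}`, not
`C²`: its second derivative jumps at `|t| = 2/3`, which is all the lattice second differences need).  Imports: p13's `BIJ88ConvexWeights227`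
(→ b2b/p38's `B4Sect5CubeBounds`), Mathlib's mean value theorem and the derivative of `cos`.  Literature + Mathlib only.
Unit `lit-balaban-p29` (literature-prover-lit-balaban-p29-g28-0), 2026-08-22.  NOT summit progress.
-/

namespace Literature.MathematicalPhysics.QuantumFieldTheory.BalabanImbrieJaffe1984to88.BIJ88ConvexWeights227SecondDiff

open Real Set Filter Topology
open Literature.MathematicalPhysics.QuantumFieldTheory.Balaban1983to89
open B4Sect5CubeBounds (clamp01 prof hfun prof_nonneg prof_le_one abs_prof_sub_le)
open BIJ88ConvexWeights227 (cwt cwt_nonneg cwt_le_one)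

noncomputable section

/-! ## §1 The clamp `u ↦ max(0, min(1, u))` -/

/-- kernel: `clamp₀₁ u = 0` for `u ≤ 0`. [folklore] -/
private theorem clamp01_of_nonpos {u : ℝ} (hu : u ≤ 0) : clamp01 u = 0 := by
  unfold clamp01; rw [min_eq_right (by linarith : u ≤ 1), max_eq_left hu]

/-- kernel: `clamp₀₁ u = 1` for `u ≥ 1`. [folklore] -/
private theorem clamp01_of_one_le {u : ℝ} (hu : 1 ≤ u) : clamp01 u = 1 := by
  unfold clamp01; rw [min_eq_left hu]; norm_num

/-- kernel: `clamp₀₁ u = u` on `[0, 1]`. [folklore] -/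
private theorem clamp01_of_mem {u : ℝ} (h0 : 0 ≤ u) (h1 : u ≤ 1) : clamp01 u = u := by
  unfold clamp01; rw [min_eq_right h1, max_eq_right h0]

/-- kernel: `clamp₀₁` is 1-Lipschitz. [folklore] -/
private theorem abs_clamp01_sub_le (u v : ℝ) : |clamp01 u - clamp01 v| ≤ |u - v| := by
  unfold clamp01
  calc |max 0 (min 1 u) - max 0 (min 1 v)| ≤ max |(0 : ℝ) - 0| |min 1 u - min 1 v| :=
        abs_max_sub_max_le_max _ _ _ _
    _ ≤ max |(0 : ℝ) - 0| (max |(1:ℝ) - 1| |u - v|) :=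
        max_le_max le_rfl (abs_min_sub_min_le_max _ _ _ _)
    _ = |u - v| := by simp [abs_nonneg]

/-! ## §2 `Ψ(u) = cos(π·clamp₀₁ u)` is `C¹` on `ℝ` with derivative `Ψ′(u) = −π sin(π·clamp₀₁ u)` -/

/-- kernel: the smooth branch, `d/dv cos(πv) = −π sin(πv)`. [folklore] -/
private theorem hasDerivAt_cos_pi_mul (v : ℝ) : HasDerivAt (fun v : ℝ => Real.cos (π * v)) (-(π * Real.sin (π * v))) v := by
  have h1 : HasDerivAt (fun v : ℝ => π * v) π v := by simpa using (hasDerivAt_id v).const_mul π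
  have h2 := (Real.hasDerivAt_cos (π * v)).comp v h1
  have e : (Real.cos ∘ fun v : ℝ => π * v) = fun v => Real.cos (π * v) := rfl
  rw [e] at h2
  have e2 : -(π * Real.sin (π * v)) = -Real.sin (π * v) * π := by ring
  rw [e2]
  exact h2

/-- **`Ψ(u) = cos(π·clamp₀₁ u)` is differentiable EVERYWHERE, `Ψ′(u) = −π sin(π·clamp₀₁ u)`** — on `u ≤ 0` and `u ≥ 1` it is locally constant and
`sin 0 = sin π = 0`, so the one-sided derivatives agree at the two clamping points: the squared profile `h²` of [6] p. 575 behind p13's weights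
is `C¹` although `h` itself is only Lipschitz. [cite: Balaban1983RegularityDecay, p.575] -/
theorem hasDerivAt_cos_pi_clamp01 (u : ℝ) :
    HasDerivAt (fun u => Real.cos (π * clamp01 u)) (-(π * Real.sin (π * clamp01 u))) u := by
  rcases lt_trichotomy u 0 with hu | hu | hu
  · -- `u < 0`: locally the constant `cos 0`
    have hev : (fun u => Real.cos (π * clamp01 u)) =ᶠ[𝓝 u] fun _ => Real.cos (π * 0) := by
      filter_upwards [Iio_mem_nhds hu] with v hv
      rw [clamp01_of_nonpos (le_of_lt hv)]
    rw [clamp01_of_nonpos hu.le, mul_zero, Real.sin_zero, mul_zero, neg_zero]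
    exact (hasDerivAt_const u (Real.cos (π * 0))).congr_of_eventuallyEq hev
  · -- `u = 0`: glue the constant left branch and the smooth right branch (both derivatives vanish)
    subst hu
    rw [clamp01_of_nonpos le_rfl, mul_zero, Real.sin_zero, mul_zero, neg_zero]
    have hpt : Real.cos (π * clamp01 0) = Real.cos (π * 0) := by rw [clamp01_of_nonpos le_rfl]
    have hL : HasDerivWithinAt (fun u => Real.cos (π * clamp01 u)) 0 (Iic 0) 0 := by
      have hev : (fun u => Real.cos (π * clamp01 u)) =ᶠ[𝓝[Iic 0] 0] fun _ => Real.cos (π * 0) := by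
        filter_upwards [self_mem_nhdsWithin] with v hv
        rw [clamp01_of_nonpos (show v ≤ 0 from hv)]
      exact (hasDerivWithinAt_const (0 : ℝ) (Iic 0) (Real.cos (π * 0))).congr_of_eventuallyEq hev hpt
    have hR : HasDerivWithinAt (fun u => Real.cos (π * clamp01 u)) 0 (Ici 0) 0 := by
      have h0 := (hasDerivAt_cos_pi_mul 0).hasDerivWithinAt (s := Ici 0)
      rw [mul_zero, Real.sin_zero, mul_zero, neg_zero] at h0
      have hev : (fun u => Real.cos (π * clamp01 u)) =ᶠ[𝓝[Ici 0] 0] fun v => Real.cos (π * v) := by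
        filter_upwards [Ico_mem_nhdsGE (zero_lt_one' ℝ)] with v hv
        rw [clamp01_of_mem hv.1 hv.2.le]
      exact h0.congr_of_eventuallyEq hev hpt
    have h := hL.union hR
    rwa [Iic_union_Ici, hasDerivWithinAt_univ] at h
  rcases lt_trichotomy u 1 with h1 | h1 | h1
  · -- `0 < u < 1`: the smooth branch
    have hev : (fun u => Real.cos (π * clamp01 u)) =ᶠ[𝓝 u] fun v => Real.cos (π * v) := by
      filter_upwards [Ioo_mem_nhds hu h1] with v hv
      rw [clamp01_of_mem hv.1.le hv.2.le]
    rw [clamp01_of_mem hu.le h1.le]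
    exact (hasDerivAt_cos_pi_mul u).congr_of_eventuallyEq hev
  · -- `u = 1`: glue the smooth left branch and the constant right branch (both derivatives vanish)
    subst h1
    rw [clamp01_of_one_le le_rfl, mul_one, Real.sin_pi, mul_zero, neg_zero]
    have hpt : Real.cos (π * clamp01 1) = Real.cos (π * 1) := by rw [clamp01_of_one_le le_rfl]
    have hL : HasDerivWithinAt (fun u => Real.cos (π * clamp01 u)) 0 (Iic 1) 1 := by
      have h0 := (hasDerivAt_cos_pi_mul 1).hasDerivWithinAt (s := Iic 1)
      rw [mul_one, Real.sin_pi, mul_zero, neg_zero] at h0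
      have hev : (fun u => Real.cos (π * clamp01 u)) =ᶠ[𝓝[Iic 1] 1] fun v => Real.cos (π * v) := by
        filter_upwards [Ioc_mem_nhdsLE (zero_lt_one' ℝ)] with v hv
        rw [clamp01_of_mem hv.1.le hv.2]
      exact h0.congr_of_eventuallyEq hev hpt
    have hR : HasDerivWithinAt (fun u => Real.cos (π * clamp01 u)) 0 (Ici 1) 1 := by
      have hev : (fun u => Real.cos (π * clamp01 u)) =ᶠ[𝓝[Ici 1] 1] fun _ => Real.cos (π * 1) := by
        filter_upwards [self_mem_nhdsWithin] with v hv
        rw [clamp01_of_one_le (show 1 ≤ v from hv)]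
      exact (hasDerivWithinAt_const (1 : ℝ) (Ici 1) (Real.cos (π * 1))).congr_of_eventuallyEq hev hpt
    have h := hL.union hR
    rwa [Iic_union_Ici, hasDerivWithinAt_univ] at h
  · -- `u > 1`: locally the constant `cos π`
    have hev : (fun u => Real.cos (π * clamp01 u)) =ᶠ[𝓝 u] fun _ => Real.cos (π * 1) := by
      filter_upwards [Ioi_mem_nhds h1] with v hv
      rw [clamp01_of_one_le (le_of_lt hv)]
    rw [clamp01_of_one_le h1.le, mul_one, Real.sin_pi, mul_zero, neg_zero]
    exact (hasDerivAt_const u (Real.cos (π * 1))).congr_of_eventuallyEq hev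

/-- `|Ψ′| ≤ π`. [cite: Balaban1983RegularityDecay, p.575] -/
theorem abs_dcos_pi_clamp01_le (u : ℝ) : |-(π * Real.sin (π * clamp01 u))| ≤ π := by
  rw [abs_neg, abs_mul, abs_of_pos Real.pi_pos]
  calc π * |Real.sin (π * clamp01 u)| ≤ π * 1 := mul_le_mul_of_nonneg_left (Real.abs_sin_le_one _) Real.pi_pos.le
    _ = π := mul_one π

/-- **`Ψ′` is `π²`-Lipschitz**: `|Ψ′(u) − Ψ′(v)| ≤ π²|u − v|` (`sin` and the clamp are 1-Lipschitz). [cite: Balaban1983RegularityDecay, p.575] -/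
theorem abs_dcos_pi_clamp01_sub_le (u v : ℝ) :
    |-(π * Real.sin (π * clamp01 u)) - -(π * Real.sin (π * clamp01 v))| ≤ π ^ 2 * |u - v| := by
  rw [neg_sub_neg, ← mul_sub, abs_mul, abs_of_pos Real.pi_pos]
  calc π * |Real.sin (π * clamp01 v) - Real.sin (π * clamp01 u)| ≤ π * |π * clamp01 v - π * clamp01 u| :=
        mul_le_mul_of_nonneg_left (Real.abs_sin_sub_sin_le _ _) Real.pi_pos.le
    _ = π ^ 2 * |clamp01 v - clamp01 u| := by rw [← mul_sub, abs_mul, abs_of_pos Real.pi_pos]; ring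
    _ ≤ π ^ 2 * |u - v| := by
        rw [abs_sub_comm u v]
        exact mul_le_mul_of_nonneg_left (abs_clamp01_sub_le v u) (by positivity)

/-- **`Ψ` is `π`-Lipschitz**: `|Ψ(u) − Ψ(v)| ≤ π|u − v|`. [cite: Balaban1983RegularityDecay, p.575] -/
theorem abs_cos_pi_clamp01_sub_le (u v : ℝ) : |Real.cos (π * clamp01 u) - Real.cos (π * clamp01 v)| ≤ π * |u - v| := by
  calc |Real.cos (π * clamp01 u) - Real.cos (π * clamp01 v)| ≤ |π * clamp01 u - π * clamp01 v| := Real.abs_cos_sub_cos_le _ _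
    _ = π * |clamp01 u - clamp01 v| := by rw [← mul_sub, abs_mul, abs_of_pos Real.pi_pos]
    _ ≤ π * |u - v| := mul_le_mul_of_nonneg_left (abs_clamp01_sub_le u v) Real.pi_pos.le

/-! ## §3 Second differences of `Ψ` -/

/-- **`|Ψ(t + 2h) − 2Ψ(t + h) + Ψ(t)| ≤ π²h²`** — the mean value theorem applied to `g(u) = Ψ(u + h) − Ψ(u)`, whose derivative
`Ψ′(u + h) − Ψ′(u)` is `≤ π²|h|`. [cite: Balaban1983RegularityDecay, p.575] -/
theorem abs_secondDiff_cos_pi_clamp01_le (t h : ℝ) :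
    |Real.cos (π * clamp01 (t + 2 * h)) - 2 * Real.cos (π * clamp01 (t + h)) + Real.cos (π * clamp01 t)| ≤ π ^ 2 * h ^ 2 := by
  have hg : ∀ u, HasDerivAt (fun u => Real.cos (π * clamp01 (u + h)) - Real.cos (π * clamp01 u))
      (-(π * Real.sin (π * clamp01 (u + h))) - -(π * Real.sin (π * clamp01 u))) u := by
    intro u
    have h1 : HasDerivAt (fun v => Real.cos (π * clamp01 (v + h))) (-(π * Real.sin (π * clamp01 (u + h)))) u := by
      have := (hasDerivAt_cos_pi_clamp01 (u + h)).comp u ((hasDerivAt_id u).add_const h)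
      simpa [Function.comp_def] using this
    exact h1.sub (hasDerivAt_cos_pi_clamp01 u)
  have hgb : ∀ u, |-(π * Real.sin (π * clamp01 (u + h))) - -(π * Real.sin (π * clamp01 u))| ≤ π ^ 2 * |h| := by
    intro u
    have := abs_dcos_pi_clamp01_sub_le (u + h) u
    rwa [add_sub_cancel_left] at this
  have hmv := Convex.norm_image_sub_le_of_norm_deriv_le
    (f := fun u => Real.cos (π * clamp01 (u + h)) - Real.cos (π * clamp01 u)) (s := Set.univ) (x := t) (y := t + h)
    (fun u _ => (hg u).differentiableAt) (fun u _ => by rw [(hg u).deriv, Real.norm_eq_abs]; exact hgb u) convex_univ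
    (Set.mem_univ _) (Set.mem_univ _)
  rw [Real.norm_eq_abs, Real.norm_eq_abs, add_sub_cancel_left] at hmv
  have e1 : Real.cos (π * clamp01 (t + h + h)) - Real.cos (π * clamp01 (t + h)) -
      (Real.cos (π * clamp01 (t + h)) - Real.cos (π * clamp01 t)) =
      Real.cos (π * clamp01 (t + 2 * h)) - 2 * Real.cos (π * clamp01 (t + h)) + Real.cos (π * clamp01 t) := by ring_nf
  rw [e1] at hmv
  calc _ ≤ π ^ 2 * |h| * |h| := hmv
    _ = π ^ 2 * h ^ 2 := by rw [mul_assoc, ← abs_mul, abs_mul_self]; ring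

/-! ## §4 The discrete product rule -/

/-- **discrete product rule**: `(fg)₂ − 2(fg)₁ + (fg)₀ = (f₂ − 2f₁ + f₀)g₂ + f₀(g₂ − 2g₁ + g₀) + 2(f₁ − f₀)(g₂ − g₁)`. [folklore] -/
private theorem secondDiff_mul (f₀ f₁ f₂ g₀ g₁ g₂ : ℝ) :
    f₂ * g₂ - 2 * (f₁ * g₁) + f₀ * g₀ = (f₂ - 2 * f₁ + f₀) * g₂ + f₀ * (g₂ - 2 * g₁ + g₀) + 2 * ((f₁ - f₀) * (g₂ - g₁)) := by
  ring

/-- **second differences of a product of two `[0,1]`-valued sequences**: with `|Δ²f| ≤ A`, `|Δ²g| ≤ B`, `|Δf| ≤ a`, `|Δg| ≤ b` one has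
`|Δ²(fg)| ≤ A + B + 2ab`. [folklore] -/
private theorem abs_secondDiff_mul_le {f₀ f₁ f₂ g₀ g₁ g₂ A B a b : ℝ} (hf0 : |f₀| ≤ 1) (hg2 : |g₂| ≤ 1)
    (hA : |f₂ - 2 * f₁ + f₀| ≤ A) (hB : |g₂ - 2 * g₁ + g₀| ≤ B) (ha : |f₁ - f₀| ≤ a) (hb : |g₂ - g₁| ≤ b) :
    |f₂ * g₂ - 2 * (f₁ * g₁) + f₀ * g₀| ≤ A + B + 2 * (a * b) := by
  have hA0 : 0 ≤ A := (abs_nonneg _).trans hA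
  have hB0 : 0 ≤ B := (abs_nonneg _).trans hB
  have ha0 : 0 ≤ a := (abs_nonneg _).trans ha
  rw [secondDiff_mul]
  refine (abs_add_le _ _).trans (add_le_add ((abs_add_le _ _).trans (add_le_add ?_ ?_)) ?_)
  · rw [abs_mul]
    calc |f₂ - 2 * f₁ + f₀| * |g₂| ≤ A * 1 := mul_le_mul hA hg2 (abs_nonneg _) hA0
      _ = A := mul_one A
  · rw [abs_mul]
    calc |f₀| * |g₂ - 2 * g₁ + g₀| ≤ 1 * B := mul_le_mul hf0 hB (abs_nonneg _) zero_le_one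
      _ = B := one_mul B
  · rw [abs_mul, abs_two, abs_mul]
    exact mul_le_mul_of_nonneg_left (mul_le_mul ha hb (abs_nonneg _) ha0) zero_le_two

/-! ## §5 The squared profile `prof² = ψ(3t − 1)·ψ(−3t − 1)`, `ψ = (1 + Ψ)/2` -/

/-- **`prof(t)² = ψ(3t − 1)·ψ(−3t − 1)`** with `ψ(u) = (1 + cos(π·clamp₀₁ u))/2`: `cos²(x/2) = (1 + cos x)/2`, and the factor of the
far side equals `1` (`clamp₀₁(−3|t| − 1) = 0`). [cite: Balaban1983RegularityDecay, p.575] -/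
theorem prof_sq_eq (t : ℝ) :
    prof t ^ 2 = (1 + Real.cos (π * clamp01 (3 * t - 1))) / 2 * ((1 + Real.cos (π * clamp01 (-3 * t - 1))) / 2) := by
  have key : ∀ u : ℝ, prof u ^ 2 = (1 + Real.cos (π * clamp01 (3 * |u| - 1))) / 2 := by
    intro u
    unfold prof
    rw [Real.cos_sq]
    ring_nf
  rw [key]
  rcases le_or_gt 0 t with ht | ht
  · rw [abs_of_nonneg ht, clamp01_of_nonpos (by linarith : -3 * t - 1 ≤ 0), mul_zero, Real.cos_zero]
    ring
  · rw [abs_of_neg ht, clamp01_of_nonpos (by linarith : 3 * t - 1 ≤ 0), mul_zero, Real.cos_zero]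
    ring

/-- kernel: `0 ≤ ψ ≤ 1` in absolute value. [folklore] -/
private theorem abs_psi_le_one (u : ℝ) : |(1 + Real.cos (π * clamp01 u)) / 2| ≤ 1 := by
  have h1 := Real.cos_le_one (π * clamp01 u)
  have h2 := Real.neg_one_le_cos (π * clamp01 u)
  rw [abs_le]; constructor <;> linarith

/-- kernel: first differences of `ψ`: `|ψ(u) − ψ(v)| ≤ (π/2)|u − v|`. [folklore] -/
private theorem abs_psi_sub_le (u v : ℝ) :
    |(1 + Real.cos (π * clamp01 u)) / 2 - (1 + Real.cos (π * clamp01 v)) / 2| ≤ π / 2 * |u - v| := by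
  have e : (1 + Real.cos (π * clamp01 u)) / 2 - (1 + Real.cos (π * clamp01 v)) / 2 =
      (Real.cos (π * clamp01 u) - Real.cos (π * clamp01 v)) / 2 := by ring
  rw [e, abs_div, abs_two]
  have := abs_cos_pi_clamp01_sub_le u v
  linarith

/-- kernel: second differences of `ψ` along a progression of step `h`: `≤ (π²/2)h²`. [folklore] -/
private theorem abs_secondDiff_psi_le (t h : ℝ) :
    |(1 + Real.cos (π * clamp01 (t + 2 * h))) / 2 - 2 * ((1 + Real.cos (π * clamp01 (t + h))) / 2) +
        (1 + Real.cos (π * clamp01 t)) / 2| ≤ π ^ 2 / 2 * h ^ 2 := by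
  have e : (1 + Real.cos (π * clamp01 (t + 2 * h))) / 2 - 2 * ((1 + Real.cos (π * clamp01 (t + h))) / 2) +
      (1 + Real.cos (π * clamp01 t)) / 2 =
      (Real.cos (π * clamp01 (t + 2 * h)) - 2 * Real.cos (π * clamp01 (t + h)) + Real.cos (π * clamp01 t)) / 2 := by ring
  rw [e, abs_div, abs_two]
  have := abs_secondDiff_cos_pi_clamp01_le t h
  linarith

/-- **first differences of the squared profile**: `|prof(a)² − prof(b)²| ≤ 3π|a − b|` ([6]'s `|h(x) − h(x′)| ≤ (3π/2)|x − x′|` and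
`|p² − q²| ≤ 2|p − q|` on `[0,1]`). [cite: Balaban1983RegularityDecay, p.595 (first kernel estimate)] -/
theorem abs_prof_sq_sub_le (a b : ℝ) : |prof a ^ 2 - prof b ^ 2| ≤ 3 * π * |a - b| := by
  have h1 := abs_prof_sub_le a b
  have hsum : |prof a + prof b| ≤ 2 := by
    rw [abs_of_nonneg (by linarith [prof_nonneg a, prof_nonneg b])]
    linarith [prof_le_one a, prof_le_one b]
  calc |prof a ^ 2 - prof b ^ 2| = |prof a + prof b| * |prof a - prof b| := by rw [sq_sub_sq, abs_mul]
    _ ≤ 2 * (3 * π / 2 * |a - b|) := mul_le_mul hsum h1 (abs_nonneg _) zero_le_two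
    _ = 3 * π * |a - b| := by ring

/-- **SECOND DIFFERENCES OF THE SQUARED PROFILE**: `|prof(t + 2h)² − 2prof(t + h)² + prof(t)²| ≤ (27π²/2)h²` for ALL `t, h` — [6]'s profile
squared is `C^{1,1}` across the kinks of the profile itself (product rule on `ψ(3t − 1)ψ(−3t − 1)`: each factor steps by `±3h`).
[cite: Balaban1983RegularityDecay, p.575] -/
theorem abs_secondDiff_prof_sq_le (t h : ℝ) :
    |prof (t + 2 * h) ^ 2 - 2 * prof (t + h) ^ 2 + prof t ^ 2| ≤ 27 * π ^ 2 / 2 * h ^ 2 := by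
  rw [prof_sq_eq, prof_sq_eq, prof_sq_eq]
  -- the two factors along the progression
  have ef2 : 3 * (t + 2 * h) - 1 = (3 * t - 1) + 2 * (3 * h) := by ring
  have ef1 : 3 * (t + h) - 1 = (3 * t - 1) + 3 * h := by ring
  have eg2 : -3 * (t + 2 * h) - 1 = (-3 * t - 1) + 2 * (-3 * h) := by ring
  have eg1 : -3 * (t + h) - 1 = (-3 * t - 1) + -3 * h := by ring
  rw [ef2, ef1, eg2, eg1]
  have hA := abs_secondDiff_psi_le (3 * t - 1) (3 * h)
  have hB := abs_secondDiff_psi_le (-3 * t - 1) (-3 * h)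
  have ha := abs_psi_sub_le ((3 * t - 1) + 3 * h) (3 * t - 1)
  have hb := abs_psi_sub_le ((-3 * t - 1) + 2 * (-3 * h)) ((-3 * t - 1) + -3 * h)
  rw [add_sub_cancel_left] at ha
  rw [show (-3 * t - 1) + 2 * (-3 * h) - ((-3 * t - 1) + -3 * h) = -3 * h by ring] at hb
  have key := abs_secondDiff_mul_le (abs_psi_le_one (3 * t - 1)) (abs_psi_le_one ((-3 * t - 1) + 2 * (-3 * h))) hA hB ha hb
  refine key.trans (le_of_eq ?_)
  have h3 : |3 * h| = 3 * |h| := by rw [abs_mul, abs_of_pos (by norm_num : (0:ℝ) < 3)]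
  have h3' : |-3 * h| = 3 * |h| := by rw [abs_mul, abs_neg, abs_of_pos (by norm_num : (0:ℝ) < 3)]
  rw [h3, h3', show π / 2 * (3 * |h|) * (π / 2 * (3 * |h|)) = 9 / 4 * π ^ 2 * (|h| * |h|) by ring, abs_mul_abs_self]
  ring

/-! ## §6 The lattice second differences of the weights `λ_α` of (2.27) -/

variable {d : ℕ}

/-- **the weight as a product of squared profile factors**: `λ_α(x₁, x₂) = Π_μ prof(((x₁ + x₂)_μ)/(2s) − α_μ)²` (one factor per coordinate of
the midpoint sum). [cite: BalabanImbrieJaffe1988, (2.27) p.263] -/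
theorem cwt_eq_prod_sq (s : ℕ) (α x₁ x₂ : Fin d → ℤ) :
    cwt s α x₁ x₂ = ∏ μ, prof ((((x₁ + x₂) μ : ℤ) : ℝ) / ((2 * s : ℕ) : ℝ) - α μ) ^ 2 := by
  unfold cwt hfun
  rw [Finset.prod_pow]

/-- kernel: split one factor off a product over all coordinates. [folklore] -/
private theorem prod_univ_split (F : Fin d → ℝ) (κ : Fin d) : ∏ μ, F μ = F κ * ∏ μ ∈ Finset.univ.erase κ, F μ :=
  (Finset.mul_prod_erase _ _ (Finset.mem_univ κ)).symm

/-- kernel: split a second factor off. [folklore] -/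
private theorem prod_erase_split (F : Fin d → ℝ) {κ lam : Fin d} (h : κ ≠ lam) :
    ∏ μ ∈ Finset.univ.erase lam, F μ = F κ * ∏ μ ∈ (Finset.univ.erase lam).erase κ, F μ :=
  (Finset.mul_prod_erase _ _ (Finset.mem_erase.2 ⟨h, Finset.mem_univ κ⟩)).symm

/-- kernel: the products of squared profile factors lie in `[0, 1]`. [folklore] -/
private theorem abs_prod_prof_sq_le_one (S : Finset (Fin d)) (g : Fin d → ℝ) : |∏ μ ∈ S, prof (g μ) ^ 2| ≤ 1 := by
  rw [abs_of_nonneg (Finset.prod_nonneg fun μ _ => sq_nonneg _)]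
  exact Finset.prod_le_one (fun μ _ => sq_nonneg _) fun μ _ => by
    have h0 := prof_nonneg (g μ); have h1 := prof_le_one (g μ); nlinarith

/-- kernel: the step of the argument of one factor when its integer coordinate moves by `j`. [folklore] -/
private theorem arg_step (s : ℕ) (a : ℤ) (m : ℤ) (j : ℤ) :
    (((m + j : ℤ) : ℝ) / ((2 * s : ℕ) : ℝ) - a) = ((m : ℝ) / ((2 * s : ℕ) : ℝ) - a) + (j : ℝ) * (1 / ((2 * s : ℕ) : ℝ)) := by
  push_cast
  ring

/-- kernel: **one coordinate stepped once** — for midpoint sums `M₁ = M₀ + e_κ`: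
`|Π_μ prof(M₁_μ/(2s) − α_μ)² − Π_μ prof(M₀_μ/(2s) − α_μ)²| ≤ 3π/(2s)`. [cite: BalabanImbrieJaffe1988, (2.27) p.263] -/
private theorem core_single {s : ℕ} (hs : 0 < s) (α M₀ M₁ : Fin d → ℤ) (κ : Fin d)
    (h1 : ∀ μ, M₁ μ = M₀ μ + if μ = κ then 1 else 0) :
    |∏ μ, prof (((M₁ μ : ℤ) : ℝ) / ((2 * s : ℕ) : ℝ) - α μ) ^ 2 - ∏ μ, prof (((M₀ μ : ℤ) : ℝ) / ((2 * s : ℕ) : ℝ) - α μ) ^ 2| ≤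
      3 * π / (2 * s) := by
  have h2s : (0 : ℝ) < ((2 * s : ℕ) : ℝ) := by positivity
  set g : Fin d → ℝ := fun μ => ((M₀ μ : ℤ) : ℝ) / ((2 * s : ℕ) : ℝ) - α μ with hgdef
  have e0 : ∏ μ, prof (((M₀ μ : ℤ) : ℝ) / ((2 * s : ℕ) : ℝ) - α μ) ^ 2 = prof (g κ) ^ 2 * ∏ μ ∈ Finset.univ.erase κ, prof (g μ) ^ 2 := by
    rw [prod_univ_split _ κ]
  have e1 : ∏ μ, prof (((M₁ μ : ℤ) : ℝ) / ((2 * s : ℕ) : ℝ) - α μ) ^ 2 =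
      prof (g κ + 1 * (1 / ((2 * s : ℕ) : ℝ))) ^ 2 * ∏ μ ∈ Finset.univ.erase κ, prof (g μ) ^ 2 := by
    rw [prod_univ_split _ κ, h1 κ, if_pos rfl, arg_step]
    congr 1
    · simp only [hgdef, Int.cast_one]
    · refine Finset.prod_congr rfl fun μ hμ => ?_
      rw [h1 μ, if_neg (Finset.mem_erase.1 hμ).1, add_zero]
  rw [e0, e1, ← sub_mul, abs_mul, one_mul]
  have ha := abs_prof_sq_sub_le (g κ + 1 / ((2 * s : ℕ) : ℝ)) (g κ)
  rw [add_sub_cancel_left, abs_of_pos (by positivity : (0 : ℝ) < 1 / ((2 * s : ℕ) : ℝ))] at ha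
  have hq := abs_prod_prof_sq_le_one (Finset.univ.erase κ) g
  calc _ ≤ 3 * π * (1 / ((2 * s : ℕ) : ℝ)) * 1 := mul_le_mul ha hq (abs_nonneg _) (by positivity)
    _ = 3 * π / (2 * s) := by push_cast; field_simp

/-- kernel: **one coordinate stepped twice** — for midpoint sums `M₁ = M₀ + e_λ`, `M₂ = M₀ + 2e_λ`:
`|Π(M₂) − 2Π(M₁) + Π(M₀)| ≤ (27π²/8)/s²` (a second difference of one squared profile factor, the others in `[0,1]`).
[cite: BalabanImbrieJaffe1988, (2.27) p.263] -/
private theorem core_same {s : ℕ} (hs : 0 < s) (α M₀ M₁ M₂ : Fin d → ℤ) (lam : Fin d)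
    (h1 : ∀ μ, M₁ μ = M₀ μ + if μ = lam then 1 else 0) (h2 : ∀ μ, M₂ μ = M₀ μ + if μ = lam then 2 else 0) :
    |∏ μ, prof (((M₂ μ : ℤ) : ℝ) / ((2 * s : ℕ) : ℝ) - α μ) ^ 2 - 2 * ∏ μ, prof (((M₁ μ : ℤ) : ℝ) / ((2 * s : ℕ) : ℝ) - α μ) ^ 2 +
        ∏ μ, prof (((M₀ μ : ℤ) : ℝ) / ((2 * s : ℕ) : ℝ) - α μ) ^ 2| ≤ 27 * π ^ 2 / 8 / (s : ℝ) ^ 2 := by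
  have hsr : (0 : ℝ) < s := by exact_mod_cast hs
  have h2s : (0 : ℝ) < ((2 * s : ℕ) : ℝ) := by positivity
  set g : Fin d → ℝ := fun μ => ((M₀ μ : ℤ) : ℝ) / ((2 * s : ℕ) : ℝ) - α μ with hgdef
  set hstep : ℝ := 1 / ((2 * s : ℕ) : ℝ) with hhdef
  have hh : hstep = 1 / (2 * (s : ℝ)) := by rw [hhdef]; push_cast; ring
  have rest : ∀ (M : Fin d → ℤ) (j : ℤ), (∀ μ, M μ = M₀ μ + if μ = lam then j else 0) →
      ∏ μ ∈ Finset.univ.erase lam, prof (((M μ : ℤ) : ℝ) / ((2 * s : ℕ) : ℝ) - α μ) ^ 2 = ∏ μ ∈ Finset.univ.erase lam, prof (g μ) ^ 2 := by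
    intro M j hM
    refine Finset.prod_congr rfl fun μ hμ => ?_
    rw [hM μ, if_neg (Finset.mem_erase.1 hμ).1, add_zero]
  have head : ∀ (M : Fin d → ℤ) (j : ℤ), (∀ μ, M μ = M₀ μ + if μ = lam then j else 0) →
      prof (((M lam : ℤ) : ℝ) / ((2 * s : ℕ) : ℝ) - α lam) ^ 2 = prof (g lam + (j : ℝ) * hstep) ^ 2 := by
    intro M j hM
    rw [hM lam, if_pos rfl, arg_step]
  have h0' : ∀ μ, M₀ μ = M₀ μ + if μ = lam then (0 : ℤ) else 0 := fun μ => by simp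
  rw [prod_univ_split _ lam, prod_univ_split (fun μ => prof (((M₁ μ : ℤ) : ℝ) / ((2 * s : ℕ) : ℝ) - α μ) ^ 2) lam,
    prod_univ_split (fun μ => prof (((M₀ μ : ℤ) : ℝ) / ((2 * s : ℕ) : ℝ) - α μ) ^ 2) lam,
    rest M₂ 2 h2, rest M₁ 1 h1, rest M₀ 0 h0', head M₂ 2 h2, head M₁ 1 h1, head M₀ 0 h0']
  have e3 : prof (g lam + ((2 : ℤ) : ℝ) * hstep) ^ 2 * ∏ μ ∈ Finset.univ.erase lam, prof (g μ) ^ 2 -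
      2 * (prof (g lam + ((1 : ℤ) : ℝ) * hstep) ^ 2 * ∏ μ ∈ Finset.univ.erase lam, prof (g μ) ^ 2) +
      prof (g lam + ((0 : ℤ) : ℝ) * hstep) ^ 2 * ∏ μ ∈ Finset.univ.erase lam, prof (g μ) ^ 2 =
      (prof (g lam + 2 * hstep) ^ 2 - 2 * prof (g lam + hstep) ^ 2 + prof (g lam) ^ 2) *
        ∏ μ ∈ Finset.univ.erase lam, prof (g μ) ^ 2 := by
    push_cast
    rw [one_mul, zero_mul, add_zero]
    ring
  rw [e3, abs_mul]
  have hf := abs_secondDiff_prof_sq_le (g lam) hstep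
  have hq := abs_prod_prof_sq_le_one (Finset.univ.erase lam) g
  calc _ ≤ 27 * π ^ 2 / 2 * hstep ^ 2 * 1 := mul_le_mul hf hq (abs_nonneg _) (by positivity)
    _ = 27 * π ^ 2 / 8 / (s : ℝ) ^ 2 := by rw [hh]; field_simp; ring

/-- kernel: **two different coordinates stepped once each** — `M_κ = M₀ + e_κ`, `M_λ = M₀ + e_λ`, `M_κλ = M₀ + e_κ + e_λ`, `κ ≠ λ`:
`|Π(M_κλ) − Π(M_κ) − Π(M_λ) + Π(M₀)| ≤ (9π²/4)/s²` (a product of two first differences, the others in `[0,1]`).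
[cite: BalabanImbrieJaffe1988, (2.27) p.263] -/
private theorem core_mixed {s : ℕ} (hs : 0 < s) (α M₀ Mk Ml Mkl : Fin d → ℤ) {κ lam : Fin d} (hκ : κ ≠ lam)
    (hk : ∀ μ, Mk μ = M₀ μ + if μ = κ then 1 else 0) (hl : ∀ μ, Ml μ = M₀ μ + if μ = lam then 1 else 0)
    (hkl : ∀ μ, Mkl μ = M₀ μ + (if μ = κ then 1 else 0) + (if μ = lam then 1 else 0)) :
    |∏ μ, prof (((Mkl μ : ℤ) : ℝ) / ((2 * s : ℕ) : ℝ) - α μ) ^ 2 - ∏ μ, prof (((Mk μ : ℤ) : ℝ) / ((2 * s : ℕ) : ℝ) - α μ) ^ 2 -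
        ∏ μ, prof (((Ml μ : ℤ) : ℝ) / ((2 * s : ℕ) : ℝ) - α μ) ^ 2 + ∏ μ, prof (((M₀ μ : ℤ) : ℝ) / ((2 * s : ℕ) : ℝ) - α μ) ^ 2| ≤
      9 * π ^ 2 / 4 / (s : ℝ) ^ 2 := by
  have hsr : (0 : ℝ) < s := by exact_mod_cast hs
  have h2s : (0 : ℝ) < ((2 * s : ℕ) : ℝ) := by positivity
  set g : Fin d → ℝ := fun μ => ((M₀ μ : ℤ) : ℝ) / ((2 * s : ℕ) : ℝ) - α μ with hgdef
  set hstep : ℝ := 1 / ((2 * s : ℕ) : ℝ) with hhdef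
  have hh : hstep = 1 / (2 * (s : ℝ)) := by rw [hhdef]; push_cast; ring
  have hκ' : lam ≠ κ := Ne.symm hκ
  -- every midpoint sum as `M₀ + a e_κ + b e_λ`
  have form : ∀ (M : Fin d → ℤ) (a b : ℤ), (∀ μ, M μ = M₀ μ + (if μ = κ then a else 0) + (if μ = lam then b else 0)) →
      ∏ μ, prof (((M μ : ℤ) : ℝ) / ((2 * s : ℕ) : ℝ) - α μ) ^ 2 =
        prof (g lam + (b : ℝ) * hstep) ^ 2 * (prof (g κ + (a : ℝ) * hstep) ^ 2 * ∏ μ ∈ (Finset.univ.erase lam).erase κ, prof (g μ) ^ 2) := by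
    intro M a b hM
    rw [prod_univ_split _ lam, prod_erase_split _ hκ]
    congr 1
    · rw [hM lam, if_neg hκ', if_pos rfl, add_zero, arg_step]
    · congr 1
      · rw [hM κ, if_pos rfl, if_neg hκ, add_zero, arg_step]
      · refine Finset.prod_congr rfl fun μ hμ => ?_
        have h1 := Finset.mem_erase.1 hμ
        have h2 := Finset.mem_erase.1 h1.2
        rw [hM μ, if_neg h1.1, if_neg h2.1, add_zero, add_zero]
  have hk' : ∀ μ, Mk μ = M₀ μ + (if μ = κ then (1 : ℤ) else 0) + (if μ = lam then (0 : ℤ) else 0) := fun μ => by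
    rw [hk μ]; simp
  have hl' : ∀ μ, Ml μ = M₀ μ + (if μ = κ then (0 : ℤ) else 0) + (if μ = lam then (1 : ℤ) else 0) := fun μ => by
    rw [hl μ]; simp
  have h0' : ∀ μ, M₀ μ = M₀ μ + (if μ = κ then (0 : ℤ) else 0) + (if μ = lam then (0 : ℤ) else 0) := fun μ => by simp
  rw [form Mkl 1 1 hkl, form Mk 1 0 hk', form Ml 0 1 hl', form M₀ 0 0 h0']
  push_cast
  rw [one_mul, zero_mul, add_zero, add_zero]
  have e3 : ∀ a0 a1 b0 b1 Q : ℝ, a1 * (b1 * Q) - a0 * (b1 * Q) - a1 * (b0 * Q) + a0 * (b0 * Q) = (a1 - a0) * (b1 - b0) * Q :=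
    fun _ _ _ _ _ => by ring
  rw [e3, abs_mul, abs_mul]
  have ha := abs_prof_sq_sub_le (g lam + hstep) (g lam)
  have hb := abs_prof_sq_sub_le (g κ + hstep) (g κ)
  have hpos : (0 : ℝ) < hstep := by rw [hhdef]; positivity
  rw [add_sub_cancel_left, abs_of_pos hpos] at ha hb
  have hq := abs_prod_prof_sq_le_one ((Finset.univ.erase lam).erase κ) g
  have h0 : 0 ≤ 3 * π * hstep := by positivity
  calc _ ≤ 3 * π * hstep * (3 * π * hstep) * 1 := mul_le_mul (mul_le_mul ha hb (abs_nonneg _) h0) hq (abs_nonneg _) (by positivity)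
    _ = 9 * π ^ 2 / 4 / (s : ℝ) ^ 2 := by rw [hh]; field_simp; ring

/-- **ONE LATTICE STEP OF `x₁` CHANGES `λ_α` BY AT MOST `3π/(2s)`** (only the factor of the stepped coordinate moves, by `1/(2s)` in its
argument; sharper than p13's all-coordinates `abs_cwt_sub_le`). [cite: BalabanImbrieJaffe1988, (2.27) p.263] -/
theorem abs_cwt_add_single_sub_le {s : ℕ} (hs : 0 < s) (α x₁ x₂ : Fin d → ℤ) (κ : Fin d) :
    |cwt s α (x₁ + Pi.single κ 1) x₂ - cwt s α x₁ x₂| ≤ 3 * π / (2 * s) := by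
  rw [cwt_eq_prod_sq, cwt_eq_prod_sq]
  exact core_single hs α (x₁ + x₂) (x₁ + Pi.single κ 1 + x₂) κ fun μ => by
    simp only [Pi.add_apply, Pi.single_apply]
    ring

/-- **THE LATTICE SECOND DIFFERENCES OF THE WEIGHTS OF (2.27) ARE `O(s⁻²)`**: for every cube spacing `s ≥ 1`, every label `α`, all `x₁, x₂`
and ALL directions `κ, λ`,
`|λ_α(x₁ + e_κ + e_λ, x₂) − λ_α(x₁ + e_κ, x₂) − λ_α(x₁ + e_λ, x₂) + λ_α(x₁, x₂)| ≤ 4π²/s²` — the same direction twice is a second difference of one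
squared profile factor (`≤ (27π²/2)/(2s)²`), two directions a product of two first differences (`≤ (3π/(2s))²`), the other factors in `[0,1]`:
print's *"The convex combination varies smoothly with (x₁ + x₂)/2"* at SECOND order for the weights of record, modulus `O(s⁻²)`.
[cite: BalabanImbrieJaffe1988, (2.27) p.263] -/
theorem abs_cwt_secondDiff_le {s : ℕ} (hs : 0 < s) (α x₁ x₂ : Fin d → ℤ) (κ lam : Fin d) :
    |cwt s α (x₁ + Pi.single κ 1 + Pi.single lam 1) x₂ - cwt s α (x₁ + Pi.single κ 1) x₂ - cwt s α (x₁ + Pi.single lam 1) x₂ +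
        cwt s α x₁ x₂| ≤ 4 * π ^ 2 / (s : ℝ) ^ 2 := by
  have hsr : (0 : ℝ) < s := by exact_mod_cast hs
  have hs2 : (0 : ℝ) < (s : ℝ) ^ 2 := by positivity
  rw [cwt_eq_prod_sq, cwt_eq_prod_sq, cwt_eq_prod_sq, cwt_eq_prod_sq]
  by_cases hκ : κ = lam
  · -- the same direction twice
    subst hκ
    have key := core_same hs α (x₁ + x₂) (x₁ + Pi.single κ 1 + x₂) (x₁ + Pi.single κ 1 + Pi.single κ 1 + x₂) κ
      (fun μ => by simp only [Pi.add_apply, Pi.single_apply]; ring)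
      (fun μ => by simp only [Pi.add_apply, Pi.single_apply]; split_ifs <;> ring)
    have e : ∀ A B C : ℝ, A - B - B + C = A - 2 * B + C := fun _ _ _ => by ring
    rw [e]
    refine key.trans ?_
    rw [div_le_div_iff_of_pos_right hs2]
    nlinarith [Real.pi_pos]
  · -- two different directions
    have key := core_mixed hs α (x₁ + x₂) (x₁ + Pi.single κ 1 + x₂) (x₁ + Pi.single lam 1 + x₂)
      (x₁ + Pi.single κ 1 + Pi.single lam 1 + x₂) hκ
      (fun μ => by simp only [Pi.add_apply, Pi.single_apply]; ring)
      (fun μ => by simp only [Pi.add_apply, Pi.single_apply]; ring)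
      (fun μ => by simp only [Pi.add_apply, Pi.single_apply]; ring)
    refine key.trans ?_
    rw [div_le_div_iff_of_pos_right hs2]
    nlinarith [Real.pi_pos]

end

end Literature.MathematicalPhysics.QuantumFieldTheory.BalabanImbrieJaffe1984to88.BIJ88ConvexWeights227SecondDiff
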